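import Literature.Probability.Percolation.QuadCrossingFourPoint
import Literature.Probability.Percolation.QuadCrossingContinuityReduction
import HarnessLib

/-!
# Case (1) of Lemma 6.1: arcs of the re-cornered quad and "a differing crossing meets the cut `γ`"

Topic `Probability/Percolation`; proofs file towards Schramm–Smirnov's continuity Lemma 6.1
(`SchrammSmirnov2011_lemma_6_1`, file `QuadCrossingContinuity.lean`; O. Schramm, S. Smirnov, *On the
scaling limits of planar percolation*, Ann. Probab. 39 (2011), arXiv:1101.5820, §6).  Condition (1):
`[Q'] = [Q]`, `∂₀Q' = ∂₀Q`, `∂₁Q' = ∂₁Q`, and a path `γ ⊂ [Q]` of diameter `≤ δ` separates both corners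
`Q(1,1)`, `Q'(1,1)` from `∂₀Q ∪ ∂₁Q`.  The printed proof: "The event `⊞_Q Δ ⊞_{Q'}` is contained in
the event that there is a percolation cluster meeting `γ` and `∂₀Q`."  This file proves the
topology behind that sentence, on the boundary loop `L` of `Quad.exists_boundaryLoop`
(`∂₁Q = L[0,¼]`, `∂₂Q = L[¼,½]`, `∂₃Q = L[½,¾]`, `∂₀Q = L[¾,1]`):

* `not_isPreconnected_split` — a connected subset of an injectively parametrised arc minus an
  interior point cannot meet both sides (the workhorse);
* `Quad.exists_param_corner` — **the arcs of `Q'`**: `Q'(1,1) = L t'` with `¼ < t' < ¾`,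
  `∂₂Q' = L[¼, t']` and `∂₃Q' = L[t', ¾]`;
* `Quad.meets_of_path_from_side_zero` / `Quad.meets_of_path_from_side_one` — **a path in `[Q]` from
  `∂₀Q` (resp. `∂₁Q`) to a boundary point `L t_b` lying on the loop between two separated points
  `L u₁`, `L u₂` (`u₁ < t_b ≤ u₂`, resp. `u₁ ≤ t_b < u₂`) meets `γ`** (the four-point crossing lemma
  applied to `γ`, which meets the loop on both sides of `t_b`).

## References

* O. Schramm, S. Smirnov, Ann. Probab. 39 (2011) 1768–1814, arXiv:1101.5820, proof of Lemma 6.1,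
  case (1). [SchrammSmirnov2011]
-/

noncomputable section

open scoped unitInterval
open Set Filter Metric Function Complex
open _root_.Topology

namespace Literature.Probability.Percolation

namespace QuadCrossing

variable {D : Set ℂ}

/-! ### Splitting an arc at an interior parameter -/

/-- **Splitting lemma.**  Let `L` be continuous and injective on `[lo, hi]`, `lo < s < hi`.  A
preconnected set contained in `L([lo, hi] ∖ {s})` cannot meet both `L([lo, s))` and `L((s, hi])`.
[folklore] -/
theorem not_isPreconnected_split {L : ℝ → ℂ} {lo s hi : ℝ} (hL : ContinuousOn L (Icc lo hi))
    (hinj : InjOn L (Icc lo hi)) (hlo : lo ≤ s) (hhi : s ≤ hi) {S : Set ℂ} (hS : IsPreconnected S)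
    (hSsub : S ⊆ L '' (Icc lo hi \ {s})) (h1 : (S ∩ L '' Ico lo s).Nonempty)
    (h2 : (S ∩ L '' Ioc s hi).Nonempty) : False := by
  set A := L '' Ico lo s with hA
  set B := L '' Ioc s hi with hB
  have hAc : closure A ⊆ L '' Icc lo s := (isCompact_Icc.image_of_continuousOn
    (hL.mono (Icc_subset_Icc_right hhi))).isClosed.closure_subset_iff.2 (image_mono Ico_subset_Icc_self)
  have hBc : closure B ⊆ L '' Icc s hi := (isCompact_Icc.image_of_continuousOn
    (hL.mono (Icc_subset_Icc_left hlo))).isClosed.closure_subset_iff.2 (image_mono Ioc_subset_Icc_self)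
  -- `closure A ∩ B = ∅` and `A ∩ closure B = ∅`
  have hdis1 : ∀ z ∈ closure A, z ∉ B := by
    rintro z hz ⟨t, ht, rfl⟩
    obtain ⟨t', ht', he⟩ := hAc hz
    have := hinj ⟨ht'.1, ht'.2.trans hhi⟩ ⟨hlo.trans ht.1.le, ht.2⟩ he
    rw [this] at ht'
    exact (lt_irrefl _ (ht.1.trans_le ht'.2))
  have hdis2 : ∀ z ∈ closure B, z ∉ A := by
    rintro z hz ⟨t, ht, rfl⟩
    obtain ⟨t', ht', he⟩ := hBc hz
    have := hinj ⟨hlo.trans ht'.1, ht'.2⟩ ⟨ht.1, ht.2.le.trans hhi⟩ he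
    rw [this] at ht'
    exact (lt_irrefl _ (ht.2.trans_le ht'.1))
  have hSAB : S ⊆ A ∪ B := fun z hz => by
    obtain ⟨t, ⟨ht, hts⟩, rfl⟩ := hSsub hz
    rcases lt_or_gt_of_ne hts with h | h
    · exact Or.inl ⟨t, ⟨ht.1, h⟩, rfl⟩
    · exact Or.inr ⟨t, ⟨h, ht.2⟩, rfl⟩
  obtain ⟨z, hzS, hzu, hzv⟩ := hS (closure B)ᶜ (closure A)ᶜ isClosed_closure.isOpen_compl
    isClosed_closure.isOpen_compl (fun z hz => by
      rcases hSAB hz with h | h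
      · exact Or.inl fun hc => hdis2 z hc h
      · exact Or.inr fun hc => hdis1 z hc h)
    (by obtain ⟨z, hzS, hzA⟩ := h1; exact ⟨z, hzS, fun hc => hdis2 z hc hzA⟩)
    (by obtain ⟨z, hzS, hzB⟩ := h2; exact ⟨z, hzS, fun hc => hdis1 z hc hzB⟩)
  rcases hSAB hzS with h | h
  · exact hzv (subset_closure h)
  · exact hzu (subset_closure h)

/-! ### Corners and arcs of the re-cornered quad -/

namespace Quad

variable {Q Q' : Quad D}

/-- Consecutive sides of a quad meet exactly at the common corner. [cite: SchrammSmirnov2011, §1.3] -/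
theorem side_inter_side (Q : Quad D) :
    Q.side 0 ∩ Q.side 1 = {Q (0, 0)} ∧ Q.side 1 ∩ Q.side 2 = {Q (1, 0)} ∧
      Q.side 2 ∩ Q.side 3 = {Q (1, 1)} ∧ Q.side 3 ∩ Q.side 0 = {Q (0, 1)} := by
  refine ⟨?_, ?_, ?_, ?_⟩
  · ext z; constructor
    · rintro ⟨⟨p, hp, rfl⟩, ⟨q, hq, hpq⟩⟩
      have := Q.injective_toFun hpq; subst this
      simp only [mem_setOf_eq] at hp hq
      rw [mem_singleton_iff, show q = ((0 : I), (0 : I)) from Prod.ext hp hq]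
    · rintro rfl; exact ⟨⟨(0, 0), rfl, rfl⟩, ⟨(0, 0), rfl, rfl⟩⟩
  · ext z; constructor
    · rintro ⟨⟨p, hp, rfl⟩, ⟨q, hq, hpq⟩⟩
      have := Q.injective_toFun hpq; subst this
      simp only [mem_setOf_eq] at hp hq
      rw [mem_singleton_iff, show q = ((1 : I), (0 : I)) from Prod.ext hq hp]
    · rintro rfl; exact ⟨⟨(1, 0), rfl, rfl⟩, ⟨(1, 0), rfl, rfl⟩⟩
  · ext z; constructor
    · rintro ⟨⟨p, hp, rfl⟩, ⟨q, hq, hpq⟩⟩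
      have := Q.injective_toFun hpq; subst this
      simp only [mem_setOf_eq] at hp hq
      rw [mem_singleton_iff, show q = ((1 : I), (1 : I)) from Prod.ext hp hq]
    · rintro rfl; exact ⟨⟨(1, 1), rfl, rfl⟩, ⟨(1, 1), rfl, rfl⟩⟩
  · ext z; constructor
    · rintro ⟨⟨p, hp, rfl⟩, ⟨q, hq, hpq⟩⟩
      have := Q.injective_toFun hpq; subst this
      simp only [mem_setOf_eq] at hp hq
      rw [mem_singleton_iff, show q = ((0 : I), (1 : I)) from Prod.ext hq hp]
    · rintro rfl; exact ⟨⟨(0, 1), rfl, rfl⟩, ⟨(0, 1), rfl, rfl⟩⟩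

/-- A side minus its far corner is preconnected (image of a half-open edge). [folklore] -/
theorem isPreconnected_side_diff (Q : Quad D) :
    IsPreconnected (Q.side 1 \ {Q (1, 0)}) ∧ IsPreconnected (Q.side 2 \ {Q (1, 1)}) ∧
      IsPreconnected (Q.side 3 \ {Q (1, 1)}) ∧ IsPreconnected (Q.side 0 \ {Q (0, 1)}) := by
  have key : ∀ (f : I → I × I), Continuous f → Function.Injective f →
      IsPreconnected ((Q ∘ f) '' Iio 1) := fun f hf hinj =>
    (isPreconnected_Iio).image _ ((Q.continuous_toFun.comp hf).continuousOn)
  refine ⟨?_, ?_, ?_, ?_⟩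
  · convert key (fun x => (x, 0)) (continuous_id.prodMk continuous_const)
      (fun a b h => congrArg Prod.fst h) using 1
    ext z; constructor
    · rintro ⟨⟨p, hp, rfl⟩, hne⟩
      simp only [mem_setOf_eq] at hp
      refine ⟨p.1, ?_, ?_⟩
      · rcases (unitInterval.le_one p.1).eq_or_lt with h | h
        · exfalso; apply hne; rw [mem_singleton_iff]
          congr 1; exact Prod.ext (Subtype.ext h) hp
        · exact h
      · simp only [comp_apply]; congr 1; exact Prod.ext rfl hp.symm
    · rintro ⟨x, hx, rfl⟩
      refine ⟨⟨(x, 0), rfl, rfl⟩, fun h => ?_⟩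
      rw [mem_singleton_iff] at h
      have := Q.injective_toFun h
      exact (ne_of_lt hx) (congrArg Prod.fst this)
  · convert key (fun y => (1, y)) (continuous_const.prodMk continuous_id)
      (fun a b h => congrArg Prod.snd h) using 1
    ext z; constructor
    · rintro ⟨⟨p, hp, rfl⟩, hne⟩
      simp only [mem_setOf_eq] at hp
      refine ⟨p.2, ?_, ?_⟩
      · rcases (unitInterval.le_one p.2).eq_or_lt with h | h
        · exfalso; apply hne; rw [mem_singleton_iff]
          congr 1; exact Prod.ext hp (Subtype.ext h)
        · exact h
      · simp only [comp_apply]; congr 1; exact Prod.ext hp.symm rfl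
    · rintro ⟨y, hy, rfl⟩
      refine ⟨⟨(1, y), rfl, rfl⟩, fun h => ?_⟩
      rw [mem_singleton_iff] at h
      have := Q.injective_toFun h
      exact (ne_of_lt hy) (congrArg Prod.snd this)
  · convert key (fun x => (x, 1)) (continuous_id.prodMk continuous_const)
      (fun a b h => congrArg Prod.fst h) using 1
    ext z; constructor
    · rintro ⟨⟨p, hp, rfl⟩, hne⟩
      simp only [mem_setOf_eq] at hp
      refine ⟨p.1, ?_, ?_⟩
      · rcases (unitInterval.le_one p.1).eq_or_lt with h | h
        · exfalso; apply hne; rw [mem_singleton_iff]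
          congr 1; exact Prod.ext (Subtype.ext h) hp
        · exact h
      · simp only [comp_apply]; congr 1; exact Prod.ext rfl hp.symm
    · rintro ⟨x, hx, rfl⟩
      refine ⟨⟨(x, 1), rfl, rfl⟩, fun h => ?_⟩
      rw [mem_singleton_iff] at h
      have := Q.injective_toFun h
      exact (ne_of_lt hx) (congrArg Prod.fst this)

  · convert key (fun y => (0, y)) (continuous_const.prodMk continuous_id)
      (fun a b h => congrArg Prod.snd h) using 1
    ext z; constructor
    · rintro ⟨⟨p, hp, rfl⟩, hne⟩
      simp only [mem_setOf_eq] at hp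
      refine ⟨p.2, ?_, ?_⟩
      · rcases (unitInterval.le_one p.2).eq_or_lt with h | h
        · exfalso; apply hne; rw [mem_singleton_iff]
          congr 1; exact Prod.ext hp (Subtype.ext h)
        · exact h
      · simp only [comp_apply]; congr 1; exact Prod.ext hp.symm rfl
    · rintro ⟨y, hy, rfl⟩
      refine ⟨⟨(0, y), rfl, rfl⟩, fun h => ?_⟩
      rw [mem_singleton_iff] at h
      have := Q.injective_toFun h
      exact (ne_of_lt hy) (congrArg Prod.snd this)

/-- **The arcs of the re-cornered quad.**  Let `L` be a loop as in `Quad.exists_boundaryLoop` for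
`Q`, and let `Q'` have the same carrier with `∂₀Q' = ∂₀Q`, `∂₁Q' = ∂₁Q`.  Then the free corner is
`Q'(1,1) = L t'` for some `¼ < t' < ¾`, and `∂₂Q' = L[¼, t']`, `∂₃Q' = L[t', ¾]`.
[cite: SchrammSmirnov2011, Lemma 6.1 (1)] -/
theorem exists_param_corner {L : ℝ → ℂ} (hLc : Continuous L) (hLp : Function.Periodic L 1)
    (hLinj : InjOn L (Ico 0 1))
    (hLr : range L = frontier Q.carrier) (hL1 : L '' Icc 0 (1 / 4) = Q.side 1)
    (hL2 : L '' Icc (1 / 4) (1 / 2) = Q.side 2) (hL3 : L '' Icc (1 / 2) (3 / 4) = Q.side 3)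
    (hL0 : L '' Icc (3 / 4) 1 = Q.side 0) (hcar : Q'.carrier = Q.carrier)
    (h0 : Q'.side 0 = Q.side 0) (h1 : Q'.side 1 = Q.side 1) :
    ∃ t' ∈ Ioo (1 / 4 : ℝ) (3 / 4), Q' (1, 1) = L t' ∧ Q'.side 2 = L '' Icc (1 / 4) t' ∧
      Q'.side 3 = L '' Icc t' (3 / 4) := by
  obtain ⟨i01, i12, i23, i30⟩ := Q.side_inter_side
  obtain ⟨i01', -, i23', -⟩ := Q'.side_inter_side
  obtain ⟨pc1', pc2', pc3', pc0'⟩ := Q'.isPreconnected_side_diff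
  have hL10 : L 1 = L 0 := by simpa using hLp 0
  have hinj01 : InjOn L (Icc 0 (3 / 4)) := fun a ha b hb hab =>
    hLinj ⟨ha.1, by linarith [ha.2]⟩ ⟨hb.1, by linarith [hb.2]⟩ hab
  have hinj1 : InjOn L (Icc (3 / 4) 1) := by
    intro a ha b hb hab
    rcases ha.2.eq_or_lt with rfl | ha1
    · rcases hb.2.eq_or_lt with rfl | hb1
      · rfl
      · exfalso
        rw [hL10] at hab
        have := hLinj ⟨le_rfl, zero_lt_one⟩ ⟨by linarith [hb.1], hb1⟩ hab
        linarith [hb.1]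
    · rcases hb.2.eq_or_lt with rfl | hb1
      · exfalso
        rw [hL10] at hab
        have := hLinj ⟨by linarith [ha.1], ha1⟩ ⟨le_rfl, zero_lt_one⟩ hab
        linarith [ha.1]
      · exact hLinj ⟨by linarith [ha.1], ha1⟩ ⟨by linarith [hb.1], hb1⟩ hab
  -- parameters of boundary points
  have hparam : ∀ z ∈ frontier Q.carrier, ∃ u ∈ Ico (0 : ℝ) 1, L u = z := by
    intro z hz
    rw [← hLr] at hz
    obtain ⟨t₀, rfl⟩ := hz
    refine ⟨Int.fract t₀, ⟨Int.fract_nonneg _, Int.fract_lt_one _⟩, ?_⟩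
    rw [Int.fract]
    have := hLp.sub_int_mul_eq ⌊t₀⌋ (x := t₀)
    simpa using this
  -- the fixed corners on the loop
  have hL0pt : L 0 = Q (0, 0) := by
    have h01 : L 0 ∈ Q.side 1 := hL1 ▸ ⟨0, ⟨le_rfl, by norm_num⟩, rfl⟩
    have h00 : L 0 ∈ Q.side 0 := hL0 ▸ ⟨1, ⟨by norm_num, le_rfl⟩, hL10⟩
    have : L 0 ∈ Q.side 0 ∩ Q.side 1 := ⟨h00, h01⟩
    rw [i01] at this; exact this
  have hL14 : L (1 / 4) = Q (1, 0) := by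
    have : L (1 / 4) ∈ Q.side 1 ∩ Q.side 2 :=
      ⟨hL1 ▸ ⟨1 / 4, ⟨by norm_num, le_rfl⟩, rfl⟩, hL2 ▸ ⟨1 / 4, ⟨le_rfl, by norm_num⟩, rfl⟩⟩
    rw [i12] at this; exact this
  have hL34 : L (3 / 4) = Q (0, 1) := by
    have : L (3 / 4) ∈ Q.side 3 ∩ Q.side 0 :=
      ⟨hL3 ▸ ⟨3 / 4, ⟨by norm_num, le_rfl⟩, rfl⟩, hL0 ▸ ⟨3 / 4, ⟨le_rfl, by norm_num⟩, rfl⟩⟩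
    rw [i30] at this; exact this
  -- the common corners of `Q'`
  have hc00 : Q' (0, 0) = L 0 := by
    have : Q' (0, 0) ∈ Q.side 0 ∩ Q.side 1 := by rw [← h0, ← h1, i01']; exact rfl
    rw [i01] at this; rw [hL0pt]; exact this
  -- `Q'(1,0) = L(1/4)`
  have hc10 : Q' (1, 0) = L (1 / 4) := by
    have hmem : Q' (1, 0) ∈ Q.side 1 := h1 ▸ ⟨(1, 0), rfl, rfl⟩
    rw [← hL1] at hmem
    obtain ⟨s, hs, hse⟩ := hmem
    rcases hs.2.eq_or_lt with rfl | hs4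
    · exact hse.symm
    exfalso
    rcases hs.1.eq_or_lt with rfl | hs0
    · -- `Q'(1,0) = L 0 = Q'(0,0)`
      have := Q'.injective_toFun (hse.symm.trans hc00.symm)
      simp at this
    -- `0 < s < 1/4`: removing `Q'(1,0)` would split `∂₁Q'`
    refine not_isPreconnected_split (hLc.continuousOn) (hinj01.mono (Icc_subset_Icc_right (by norm_num)))
      hs0.le hs4.le pc1' ?_ ?_ ?_
    · rintro z ⟨hz, hne⟩
      rw [h1, ← hL1] at hz
      obtain ⟨t, ht, rfl⟩ := hz
      refine ⟨t, ⟨ht, fun hts => hne ?_⟩, rfl⟩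
      rw [mem_singleton_iff, ← hse, show t = s from hts]
    · refine ⟨Q' (0, 0), ⟨⟨h1 ▸ (by rw [hc00, hL0pt]; exact ⟨(0, 0), rfl, rfl⟩), fun h => ?_⟩,
        ⟨0, ⟨le_rfl, hs0⟩, hc00.symm⟩⟩⟩
      rw [mem_singleton_iff] at h
      have := Q'.injective_toFun h; simp at this
    · refine ⟨L (1 / 4), ⟨⟨h1 ▸ (hL14 ▸ ⟨(1, 0), rfl, rfl⟩), fun h => ?_⟩, ⟨1 / 4, ⟨hs4, le_rfl⟩, rfl⟩⟩⟩
      rw [mem_singleton_iff, ← hse] at h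
      have := hinj01 ⟨by norm_num, by norm_num⟩ ⟨hs.1, by linarith⟩ h
      linarith
  -- `Q'(0,1) = L(3/4)`
  have hc01 : Q' (0, 1) = L (3 / 4) := by
    have hmem : Q' (0, 1) ∈ Q.side 0 := h0 ▸ ⟨(0, 1), rfl, rfl⟩
    rw [← hL0] at hmem
    obtain ⟨s, hs, hse⟩ := hmem
    rcases hs.1.eq_or_lt with rfl | hs3
    · exact hse.symm
    exfalso
    rcases hs.2.eq_or_lt with rfl | hs1
    · have := Q'.injective_toFun ((hse.symm.trans hL10).trans hc00.symm)
      simp at this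
    refine not_isPreconnected_split (hLc.continuousOn) hinj1 hs3.le hs1.le pc0' ?_ ?_ ?_
    · rintro z ⟨hz, hne⟩
      rw [h0, ← hL0] at hz
      obtain ⟨t, ht, rfl⟩ := hz
      refine ⟨t, ⟨ht, fun hts => hne ?_⟩, rfl⟩
      rw [mem_singleton_iff, ← hse, show t = s from hts]
    · refine ⟨L (3 / 4), ⟨⟨h0 ▸ (hL34 ▸ ⟨(0, 1), rfl, rfl⟩), fun h => ?_⟩, ⟨3 / 4, ⟨le_rfl, hs3⟩, rfl⟩⟩⟩
      rw [mem_singleton_iff, ← hse] at h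
      have := hinj1 ⟨le_rfl, by norm_num⟩ hs h
      linarith
    · refine ⟨Q' (0, 0), ⟨⟨h0 ▸ ?_, fun h => ?_⟩, ⟨1, ⟨hs1, le_rfl⟩, by rw [hL10, hc00]⟩⟩⟩
      · rw [hc00, hL0pt]; exact ⟨(0, 0), rfl, rfl⟩
      · rw [mem_singleton_iff] at h
        have := Q'.injective_toFun h; simp at this
  -- the parameter of the free corner
  have hfr : frontier Q'.carrier = frontier Q.carrier := by rw [hcar]
  obtain ⟨t', ht', hLt'⟩ := hparam (Q' (1, 1)) (hfr ▸ Q'.side_subset_frontier 2 ⟨(1, 1), rfl, rfl⟩)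
  have hc'2 : Q' (1, 1) ∈ Q'.side 2 := ⟨(1, 1), rfl, rfl⟩
  have hc'3 : Q' (1, 1) ∈ Q'.side 3 := ⟨(1, 1), rfl, rfl⟩
  -- parameter ranges of points of `∂₂Q'`, `∂₃Q'`
  have hrange2 : ∀ z ∈ Q'.side 2, ∃ u ∈ Ico (1 / 4 : ℝ) (3 / 4), L u = z := by
    intro z hz
    obtain ⟨u, hu, rfl⟩ := hparam z (hfr ▸ Q'.side_subset_frontier 2 hz)
    by_cases hu4 : u ≤ 1 / 4
    · -- then `L u ∈ ∂₁Q = ∂₁Q'`, so `L u = Q'(1,0) = L(1/4)`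
      have hz1 : L u ∈ Q'.side 1 := h1 ▸ (hL1 ▸ ⟨u, ⟨hu.1, hu4⟩, rfl⟩)
      have : L u ∈ Q'.side 1 ∩ Q'.side 2 := ⟨hz1, hz⟩
      rw [(Q'.side_inter_side).2.1, mem_singleton_iff, hc10] at this
      exact ⟨1 / 4, ⟨le_rfl, by norm_num⟩, this.symm⟩
    by_cases hu34 : 3 / 4 ≤ u
    · exfalso
      have hz0 : L u ∈ Q'.side 0 := h0 ▸ (hL0 ▸ ⟨u, ⟨hu34, hu.2.le⟩, rfl⟩)
      exact Set.disjoint_left.1 (Q'.disjoint_side_side_add_two 0) hz0 hz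
    push Not at hu4 hu34
    exact ⟨u, ⟨hu4.le, hu34⟩, rfl⟩
  have hrange3 : ∀ z ∈ Q'.side 3, ∃ u ∈ Ioc (1 / 4 : ℝ) (3 / 4), L u = z := by
    intro z hz
    obtain ⟨u, hu, rfl⟩ := hparam z (hfr ▸ Q'.side_subset_frontier 3 hz)
    by_cases hu4 : u ≤ 1 / 4
    · exfalso
      have hz1 : L u ∈ Q'.side 1 := h1 ▸ (hL1 ▸ ⟨u, ⟨hu.1, hu4⟩, rfl⟩)
      exact Set.disjoint_left.1 (Q'.disjoint_side_side_add_two 1) hz1 hz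
    by_cases hu34 : 3 / 4 ≤ u
    · have hz0 : L u ∈ Q'.side 0 := h0 ▸ (hL0 ▸ ⟨u, ⟨hu34, hu.2.le⟩, rfl⟩)
      have : L u ∈ Q'.side 3 ∩ Q'.side 0 := ⟨hz, hz0⟩
      rw [(Q'.side_inter_side).2.2.2, mem_singleton_iff, hc01] at this
      exact ⟨3 / 4, ⟨by norm_num, le_rfl⟩, this.symm⟩
    push Not at hu4 hu34
    exact ⟨u, ⟨hu4, hu34.le⟩, rfl⟩
  obtain ⟨u', hu', hu'e⟩ := hrange2 _ hc'2
  have ht'eq : t' = u' := hLinj ht' ⟨by linarith [hu'.1], by linarith [hu'.2]⟩ (hLt'.trans hu'e.symm)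
  have ht'lo : 1 / 4 < t' := by
    rcases hu'.1.eq_or_lt with h | h
    · exfalso
      -- `Q'(1,1) = L(1/4) = Q'(1,0)`
      have := Q'.injective_toFun ((hLt'.symm.trans (by rw [ht'eq, ← h])).trans hc10.symm : Q' (1, 1) = Q' (1, 0))
      simp at this
    · rwa [ht'eq]
  have ht'hi : t' < 3 / 4 := by
    obtain ⟨u'', hu'', hu''e⟩ := hrange3 _ hc'3
    have : t' = u'' := hLinj ht' ⟨by linarith [hu''.1], by linarith [hu''.2]⟩ (hLt'.trans hu''e.symm)
    rcases hu''.2.eq_or_lt with h | h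
    · exfalso
      have := Q'.injective_toFun ((hLt'.symm.trans (by rw [this, h])).trans hc01.symm : Q' (1, 1) = Q' (0, 1))
      simp at this
    · rwa [this]
  have hps : ∀ k : Fin 4, IsPreconnected (Q'.side k) := fun k => by
    have e : ∀ (P : I × I → Prop) (f : I → I × I), Continuous f → (∀ y, P (f y)) →
        (∀ p, P p → ∃ y, f y = p) → IsPreconnected (Q' '' {z | P z}) := by
      intro P f hf hPf hsurj
      have : Q' '' {z | P z} = (Q' ∘ f) '' univ := by
        ext w; constructor
        · rintro ⟨p, hp, rfl⟩
          obtain ⟨y, rfl⟩ := hsurj p hp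
          exact ⟨y, mem_univ _, rfl⟩
        · rintro ⟨y, -, rfl⟩
          exact ⟨f y, hPf y, rfl⟩
      rw [this]
      exact isPreconnected_univ.image _ (Q'.continuous_toFun.comp hf).continuousOn
    fin_cases k
    · exact e (fun z => z.1 = 0) (fun y => (0, y)) (by fun_prop) (fun _ => rfl)
        (fun p hp => ⟨p.2, Prod.ext hp.symm rfl⟩)
    · exact e (fun z => z.2 = 0) (fun x => (x, 0)) (by fun_prop) (fun _ => rfl)
        (fun p hp => ⟨p.1, Prod.ext rfl hp.symm⟩)
    · exact e (fun z => z.1 = 1) (fun y => (1, y)) (by fun_prop) (fun _ => rfl)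
        (fun p hp => ⟨p.2, Prod.ext hp.symm rfl⟩)
    · exact e (fun z => z.2 = 1) (fun x => (x, 1)) (by fun_prop) (fun _ => rfl)
        (fun p hp => ⟨p.1, Prod.ext rfl hp.symm⟩)
  have hinj13 : InjOn L (Icc (1 / 4) (3 / 4)) := hinj01.mono (Icc_subset_Icc_left (by norm_num))
  have hc'ne10 : Q' (1, 1) ≠ Q' (1, 0) := fun h => by have := Q'.injective_toFun h; simp at this
  have hc'ne01 : Q' (1, 1) ≠ Q' (0, 1) := fun h => by have := Q'.injective_toFun h; simp at this
  refine ⟨t', ⟨ht'lo, ht'hi⟩, hLt'.symm, ?_, ?_⟩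
  · -- `∂₂Q' = L[1/4, t']`
    apply Subset.antisymm
    · intro z hz
      obtain ⟨u, hu, rfl⟩ := hrange2 z hz
      refine ⟨u, ⟨hu.1, ?_⟩, rfl⟩
      by_contra hut
      push Not at hut
      refine not_isPreconnected_split hLc.continuousOn hinj13 ht'lo.le ht'hi.le pc2' ?_ ?_ ?_
      · rintro w ⟨hw, hne⟩
        obtain ⟨v, hv, rfl⟩ := hrange2 w hw
        refine ⟨v, ⟨⟨hv.1, hv.2.le⟩, fun hvt => hne ?_⟩, rfl⟩
        rw [mem_singleton_iff, ← hLt', show v = t' from hvt]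
      · refine ⟨L (1 / 4), ⟨⟨hc10 ▸ ⟨(1, 0), rfl, rfl⟩, fun h => hc'ne10 ?_⟩,
          ⟨1 / 4, ⟨le_rfl, ht'lo⟩, rfl⟩⟩⟩
        rw [mem_singleton_iff] at h
        rw [hc10, h]
      · refine ⟨L u, ⟨⟨hz, fun h => ?_⟩, ⟨u, ⟨hut, hu.2.le⟩, rfl⟩⟩⟩
        rw [mem_singleton_iff, ← hLt'] at h
        have := hLinj ⟨by linarith [hu.1], by linarith [hu.2]⟩ ht' h
        linarith
    · rintro _ ⟨u, hu, rfl⟩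
      by_contra hnot
      have hu4 : 1 / 4 < u := by
        rcases hu.1.eq_or_lt with h | h
        · exact absurd (h ▸ hc10 ▸ ⟨(1, 0), rfl, rfl⟩) hnot
        · exact h
      have hut : u < t' := by
        rcases hu.2.eq_or_lt with h | h
        · exact absurd (h ▸ hLt' ▸ hc'2) hnot
        · exact h
      refine not_isPreconnected_split hLc.continuousOn hinj13 hu4.le (by linarith) (hps 2) ?_ ?_ ?_
      · intro w hw
        obtain ⟨v, hv, rfl⟩ := hrange2 w hw
        refine ⟨v, ⟨⟨hv.1, hv.2.le⟩, fun hvu => hnot ?_⟩, rfl⟩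
        rw [← show v = u from hvu]; exact hw
      · exact ⟨L (1 / 4), hc10 ▸ ⟨(1, 0), rfl, rfl⟩, ⟨1 / 4, ⟨le_rfl, hu4⟩, rfl⟩⟩
      · exact ⟨L t', hLt' ▸ hc'2, ⟨t', ⟨hut, ht'hi.le⟩, rfl⟩⟩
  · -- `∂₃Q' = L[t', 3/4]`
    apply Subset.antisymm
    · intro z hz
      obtain ⟨u, hu, rfl⟩ := hrange3 z hz
      refine ⟨u, ⟨?_, hu.2⟩, rfl⟩
      by_contra hut
      push Not at hut
      refine not_isPreconnected_split hLc.continuousOn hinj13 ht'lo.le ht'hi.le pc3' ?_ ?_ ?_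
      · rintro w ⟨hw, hne⟩
        obtain ⟨v, hv, rfl⟩ := hrange3 w hw
        refine ⟨v, ⟨⟨hv.1.le, hv.2⟩, fun hvt => hne ?_⟩, rfl⟩
        rw [mem_singleton_iff, ← hLt', show v = t' from hvt]
      · refine ⟨L u, ⟨⟨hz, fun h => ?_⟩, ⟨u, ⟨hu.1.le, hut⟩, rfl⟩⟩⟩
        rw [mem_singleton_iff, ← hLt'] at h
        have := hLinj ⟨by linarith [hu.1], by linarith [hu.2]⟩ ht' h
        linarith
      · refine ⟨L (3 / 4), ⟨⟨hc01 ▸ ⟨(0, 1), rfl, rfl⟩, fun h => hc'ne01 ?_⟩,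
          ⟨3 / 4, ⟨ht'hi, le_rfl⟩, rfl⟩⟩⟩
        rw [mem_singleton_iff] at h
        rw [hc01, h]
    · rintro _ ⟨u, hu, rfl⟩
      by_contra hnot
      have hu4 : t' < u := by
        rcases hu.1.eq_or_lt with h | h
        · exact absurd (h ▸ hLt' ▸ hc'3) hnot
        · exact h
      have hu34 : u < 3 / 4 := by
        rcases hu.2.eq_or_lt with h | h
        · exact absurd (h ▸ hc01 ▸ ⟨(0, 1), rfl, rfl⟩) hnot
        · exact h
      refine not_isPreconnected_split hLc.continuousOn hinj13 (by linarith) hu34.le (hps 3) ?_ ?_ ?_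
      · intro w hw
        obtain ⟨v, hv, rfl⟩ := hrange3 w hw
        refine ⟨v, ⟨⟨hv.1.le, hv.2⟩, fun hvu => hnot ?_⟩, rfl⟩
        rw [← show v = u from hvu]; exact hw
      · exact ⟨L t', hLt' ▸ hc'3, ⟨t', ⟨ht'lo.le, hu4⟩, rfl⟩⟩
      · exact ⟨L (3 / 4), hc01 ▸ ⟨(0, 1), rfl, rfl⟩, ⟨3 / 4, ⟨hu34, le_rfl⟩, rfl⟩⟩

end Quad

end QuadCrossing

end Literature.Probability.Percolation
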